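import Summits.Ventures.QEC.Thresholds.DepolarizingThresholds
import Literature.InformationTheory.QuantumCodes.DepolarizingCSSConverse
import Literature.InformationTheory.QuantumCodes.SpherePackingThreshold
import HarnessLib

/-!
# Q5 packaging: the hashing CEILING for DEPOLARIZING noise decoded sector-wise —
# rate `≥ R` forces `h₂(2p_c^{depol}/3) ≤ 1 - R`, i.e. `p_c^{depol} ≤ (3/2)·h₂⁻¹(1 - R)`, for EVERY pair of sector decoders

Venture QEC, LADDER-QEC rung Q5 (qec-lit-2 gen 5). Theorem-only. The census's depolarizing rows
(`DepolarizingThresholds.depolarizingFailureFamily C DX DZ`: `X`, `Y`, `Z` each with probability `p/3`, the two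
sectors decoded separately, failure iff either residual is non-trivial) dominate the `Z`-sector failure at the
marginal phase-flip rate `2p/3` (`DepolarizingCSSConverse.zFailure_le_depolarizingFailureProb`, Dennis et al. §4.1),
and the per-sector strong converse (`SpherePackingThreshold.CSSCode.tendsto_zFailure_one`) sends that to `1` above
the hashing rate. Hence, for a census CSS family with `n_i → ∞`, `k_i ≥ R n_i`, and a depolarizing rate
`0 < p ≤ 3/4` with `(1 - R) log 2 < h(2p/3)`:

* `depol_not_belowThreshold_of_rate`: `p` is not below threshold for ANY pair of sector decoder families;
* **`depol_accuracyThreshold_le_of_rate`**: `accuracyThreshold (depolarizingFailureFamily C DX DZ) ≤ p`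
  (`p_c^{depol} ≤ (3/2) h₂⁻¹(1 - R)` on `[0, 3/4]`);
* `depol_accuracyThreshold_lt_of_rate_pos`: `R > 0` ⇒ `p_c^{depol} < 3/4` strictly.

Scope: sector-wise decoding of CSS codes only (the census convention); correlated `X/Z` decoding and the true
depolarizing hashing bound `1 - H(p) - p log₂ 3` are NOT treated; rate-0 families get nothing new (the `k ≥ 1`
ceiling `3/8` of `DepolarizingThresholdConverses` is sharper there).

## References

* [DennisEtAl2002] E. Dennis, A. Kitaev, A. Landahl, J. Preskill, J. Math. Phys. 43 (2002) 4452, §4.1 (X and Z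
  errors recovered separately; depolarizing channel) and §4.6 (R = 1 − 2H₂(p), p_c).
* [RichardsonUrbanke2008] T. Richardson, R. Urbanke, *Modern Coding Theory*, CUP 2008, §1.6 (strong converse).
* [DumerKovalevPryadko2015] I. Dumer, A. A. Kovalev, L. P. Pryadko, PRL 115 (2015) 050502, eq.
  (succesful-decoding-depolarizing).
-/

namespace Summit.Ventures.QEC.Thresholds

open Filter Topology Finset
open Literature.InformationTheory.QuantumCodes

variable {RX RZ Q : ℕ → Type*} [∀ i, Fintype (Q i)] [∀ i, DecidableEq (Q i)] [∀ i, Fintype (RX i)]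
  [∀ i, Fintype (RZ i)]

/-- **Above the hashing rate of the phase-flip MARGINAL, depolarizing noise is not below threshold** for any pair of
sector decoder families: `0 < p ≤ 3/4`, `(1 - R) log 2 < h(2p/3)`, `k_i ≥ R n_i`, `n_i → ∞`.
[cite: DennisEtAl2002, §4.1 and §4.6; RichardsonUrbanke2008, §1.6 (after Theorem 1.17)] -/
theorem depol_not_belowThreshold_of_rate (C : ∀ i, CSSCode (RX i) (RZ i) (Q i))
    (DX : ∀ i, Decoder (RZ i → ZMod 2) (Q i → ZMod 2)) (DZ : ∀ i, Decoder (RX i → ZMod 2) (Q i → ZMod 2))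
    {p R : ℝ} (hp0 : 0 < p) (hp : p ≤ 3 / 4) (hn : Tendsto (fun i => Fintype.card (Q i)) atTop atTop)
    (hR : ∀ i, R * Fintype.card (Q i) ≤ (C i).k) (hcap : (1 - R) * Real.log 2 < Real.binEntropy (2 * p / 3)) :
    ¬ BelowThreshold (depolarizingFailureFamily C DX DZ) p := by
  classical
  intro h
  have h1 := CSSCode.tendsto_zFailure_one C DZ (p := 2 * p / 3) (R := R) (by linarith) (by linarith) hn hR hcap
  have h0 : Tendsto (fun i => ∑ z ∈ univ.filter (fun z : Q i → ZMod 2 =>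
      ¬ (DZ i).Corrects (C i).zSyndrome ((C i).rowSpZ : Set (Q i → ZMod 2)) z), bernoulliWeight (2 * p / 3) (supp z))
      atTop (𝓝 0) := by
    refine squeeze_zero (fun i => sum_nonneg fun z _ => bernoulliWeight_nonneg (by linarith) (by linarith) _)
      (fun i => ?_) h
    exact (C i).zFailure_le_depolarizingFailureProb (DX i) (DZ i) hp0.le (by linarith)
  exact zero_ne_one (tendsto_nhds_unique h0 h1)

/-- **THE DEPOLARIZING HASHING CEILING (sector-wise decoding)**: `accuracyThreshold (depolarizingFailureFamily C DX DZ)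
≤ p` for every `0 < p ≤ 3/4` with `(1 - R) log 2 < h(2p/3)` — i.e. `p_c^{depol} ≤ (3/2)·h₂⁻¹(1 - R)`, every pair of
sector decoder families, every census CSS family of rate `≥ R`. [cite: DennisEtAl2002, §4.1 and §4.6 (p_c);
RichardsonUrbanke2008, §1.6] -/
theorem depol_accuracyThreshold_le_of_rate (C : ∀ i, CSSCode (RX i) (RZ i) (Q i))
    (DX : ∀ i, Decoder (RZ i → ZMod 2) (Q i → ZMod 2)) (DZ : ∀ i, Decoder (RX i → ZMod 2) (Q i → ZMod 2))
    {p R : ℝ} (hp0 : 0 < p) (hp : p ≤ 3 / 4) (hn : Tendsto (fun i => Fintype.card (Q i)) atTop atTop)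
    (hR : ∀ i, R * Fintype.card (Q i) ≤ (C i).k) (hcap : (1 - R) * Real.log 2 < Real.binEntropy (2 * p / 3)) :
    accuracyThreshold (depolarizingFailureFamily C DX DZ) ≤ p := by
  by_contra h
  exact depol_not_belowThreshold_of_rate C DX DZ hp0 hp hn hR hcap
    (belowThreshold_of_lt_accuracyThreshold hp0.le (not_le.1 h))

/-- **Positive rate ⇒ `p_c^{depol} < 3/4`** for every pair of sector decoder families (`h` is continuous at `1/2`
with `h(1/2) = log 2 > (1 - R) log 2`). [cite: DennisEtAl2002, §4.1 and §4.6] -/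
theorem depol_accuracyThreshold_lt_of_rate_pos (C : ∀ i, CSSCode (RX i) (RZ i) (Q i))
    (DX : ∀ i, Decoder (RZ i → ZMod 2) (Q i → ZMod 2)) (DZ : ∀ i, Decoder (RX i → ZMod 2) (Q i → ZMod 2))
    {R : ℝ} (hR0 : 0 < R) (hn : Tendsto (fun i => Fintype.card (Q i)) atTop atTop)
    (hR : ∀ i, R * Fintype.card (Q i) ≤ (C i).k) :
    accuracyThreshold (depolarizingFailureFamily C DX DZ) < 3 / 4 := by
  have hlt : (1 - R) * Real.log 2 < Real.binEntropy 2⁻¹ := by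
    rw [Real.binEntropy_two_inv]
    nlinarith [Real.log_pos (by norm_num : (1 : ℝ) < 2)]
  have hev : ∀ᶠ q in 𝓝 (2⁻¹ : ℝ), (1 - R) * Real.log 2 < Real.binEntropy q :=
    (Real.binEntropy_continuous.tendsto _).eventually (lt_mem_nhds hlt)
  have hIoo : Set.Ioo 0 (2⁻¹ : ℝ) ∈ 𝓝[<] (2⁻¹ : ℝ) := Ioo_mem_nhdsLT (by norm_num)
  obtain ⟨q, hq, hq0, hqhalf⟩ := ((hev.filter_mono nhdsWithin_le_nhds).and hIoo).exists
  -- depolarizing rate `3q/2 < 3/4` whose marginal is `q`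
  have h := depol_accuracyThreshold_le_of_rate C DX DZ (p := 3 * q / 2) (R := R) (by linarith) (by linarith) hn hR
    (by rw [show 2 * (3 * q / 2) / 3 = q by ring]; exact hq)
  linarith

end Summit.Ventures.QEC.Thresholds
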